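import Mathlib
import HarnessLib
import Literature.Analysis.FluidPDE.Tao2016AveragedNS.BoundedEternalSolutions
import Summits.NavierStokesRegularity.NavierStokesRegularity.Theorems.TaoLadderRungTwoBreakNoSurvivingEternalViscBddOneWeightedGrowth

/-!
# Crux `TaoLadderRungTwoBreak.NoSurvivingEternalViscBddOne` (stmt-NavierStokesRegularity-20419), child (ρ+) `NoLoudLadderOne`:
# the `1/ε₀` AMPLITUDE FLOOR for BLOCK-SELF-SIMILAR bounded admissible eternal solutions (any covariant viscosity `ν̂ ≥ 0`)

MODEL lattice ODEs only (Tao 2016 §4, §6.4; cell vocabulary `IsEternalVisc`, `physEnergy`, `bigLam`); nothing here is a statement about the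
Navier–Stokes equations; no stub, crux or summit is closed (`--supports stmt-NavierStokesRegularity-20419`).

The construction `ViscousBlockDSSWaves` (H; tree `…/WakeRatchetEternalViscousRate/Negative/…` and
`…/TaoLadderRungTwoBreakNoLoudLadderOne/Negative/NoLoudLadderOneFalseOfViscousBlockDSSWaves.lean`: H ⇒ ¬(ρ+) ⇒ ¬K1ᵛ(1)) asks for a bounded
admissible viscous eternal solution that is BLOCK-SELF-SIMILAR, `W_{n+p}(σ) = W_n(σ − T)`, at arbitrarily small `ε₀` on a fixed class
`E₂(R)`.  `blockSelfSimilar_amplitude_floor`: EVERY non-trivial bounded admissible eternal solution of a cancelling table (any `ν̂ ≥ 0`) that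
is block-self-similar with shell period `p ≥ 1` and lag `T > 0` has **`Λ ≤ C_A · sup‖W‖ · (Λ² − 1)`, i.e. `sup‖W‖ ≥ Λ/(C_A((1+ε₀)⁵−1))
≈ 1/(5C_Aε₀)`** — the same floor as for DSS profile families (`dss_amplitude_floor`), by the same mechanism (the θ-weighted growth law
`weightedSum_le` against the factor `θᵖe^{2T}Λ^{−2p}` per block along the orbit of a non-zero point; `θ ↑ Λ²`), independent of `p`, `T`
and `ν̂`.  So an H-witness at scale ratio `1+ε₀` must have renormalised amplitude `≳ 1/(320ε₀)` on `E₂(R)` (`C_A ≤ 64`): the sought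
dissipation-balanced self-similar profiles are TALL — a constraint for constructing or excluding them.  (For `ν̂ > 0` the lag is pinned,
`e^{T} = (1+ε₀)^{2p} > 1`, `viscBlockDSS_lag`, so `T > 0` is automatic there.)
HONEST LABEL: (ρ+), ⟨20419⟩ and every NS statement remain OPEN; H remains unconstructed and unrefuted.
-/

noncomputable section

-- the summit and its single sub-problem share the name (CONVENTIONS §1)
set_option linter.dupNamespace false

namespace Summit.NavierStokesRegularity.NavierStokesRegularity.Theorems.NoSurvivingEternalViscBddOne.WeightedGrowth

open Set Filter Topology MeasureTheory
open scoped RealInnerProductSpace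
open Literature.Analysis.FluidPDE Literature.Analysis.FluidPDE.TaoCascade
open Summit.NavierStokesRegularity.NavierStokesRegularity.Theorems.NoSurvivingEternalViscBddOne.SmallAction

variable {m : ℕ} {ε₀ νh : ℝ} {α : Fin m → Fin m → Fin m → ℤ × ℤ × ℤ → ℝ} {W : ℤ → ℝ → Em m}

/-- Iterating the block shift: `W_{n + jp}(σ + jT) = W_n(σ)`. [folklore] -/
theorem blockOrbit' {p : ℕ} {T : ℝ} (hD : ∀ (n : ℤ) (σ : ℝ), W (n + p) σ = W n (σ - T)) :
    ∀ (j : ℕ) (n : ℤ) (σ : ℝ), W (n + ((j * p : ℕ) : ℤ)) (σ + (j : ℝ) * T) = W n σ := by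
  intro j
  induction j with
  | zero => intro n σ; simp
  | succ j ih =>
    intro n σ
    have h1 : (n + (((j + 1) * p : ℕ) : ℤ)) = (n + ((j * p : ℕ) : ℤ)) + (p : ℤ) := by push_cast; ring
    have h2 : σ + ((j + 1 : ℕ) : ℝ) * T = (σ + (j : ℝ) * T) + T := by push_cast; ring
    rw [h1, h2, hD, add_sub_cancel_right, ih]

/-- The weighted energy along the block orbit of shell `n₁` at log-time `σ₁`:
`θ^{n₁+jp}·E_{n₁+jp}(σ₁ + jT) = (θᵖ·e^{2T}/(Λ²)ᵖ)ʲ · θ^{n₁}E_{n₁}(σ₁)`.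
[cite: Tao2016AveragedNS, §4 Lemma 4.1 (4.8)–(4.9), §6.4; cell vocabulary] -/
theorem weightedEnergy_blockOrbit (hε : 0 < ε₀) {p : ℕ} {T : ℝ} (hD : ∀ (n : ℤ) (σ : ℝ), W (n + p) σ = W n (σ - T))
    (θ : ℝ) (n₁ j : ℕ) (σ₁ : ℝ) :
    θ ^ (n₁ + j * p) * physEnergy ε₀ W ((n₁ + j * p : ℕ) : ℤ) (σ₁ + (j : ℝ) * T)
      = (θ ^ p * (Real.exp (2 * T) / (bigLam ε₀ ^ 2) ^ p)) ^ j * (θ ^ n₁ * physEnergy ε₀ W n₁ σ₁) := by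
  have hΛ : bigLam ε₀ ≠ 0 := (bigLam_pos (by linarith)).ne'
  have horb : W ((n₁ + j * p : ℕ) : ℤ) (σ₁ + (j : ℝ) * T) = W (n₁ : ℤ) σ₁ := by
    have := blockOrbit' hD j (n₁ : ℤ) σ₁
    rwa [show ((n₁ : ℕ) : ℤ) + ((j * p : ℕ) : ℤ) = ((n₁ + j * p : ℕ) : ℤ) by push_cast; ring] at this
  have hexp : Real.exp (2 * (σ₁ + (j : ℝ) * T)) = Real.exp (2 * σ₁) * Real.exp (2 * T) ^ j := by
    rw [← Real.exp_nat_mul, ← Real.exp_add]; ring_nf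
  have e1 : (bigLam ε₀ ^ (n₁ + j * p))⁻¹ ^ 2 = ((bigLam ε₀ ^ 2) ^ n₁ * ((bigLam ε₀ ^ 2) ^ p) ^ j)⁻¹ := by
    rw [inv_pow]; congr 1; ring
  have e2 : (bigLam ε₀ ^ n₁)⁻¹ ^ 2 = ((bigLam ε₀ ^ 2) ^ n₁)⁻¹ := by
    rw [inv_pow]; congr 1; ring
  have hL2 : (bigLam ε₀ ^ 2) ^ n₁ ≠ 0 := by positivity
  have hL3 : (bigLam ε₀ ^ 2) ^ p ≠ 0 := by positivity
  unfold physEnergy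
  rw [horb, zpow_natCast, zpow_natCast, e1, e2, hexp, mul_pow, div_pow, pow_add]
  field_simp
  ring

/-- **THE `1/ε₀` AMPLITUDE FLOOR FOR BLOCK-SELF-SIMILAR BOUNDED ADMISSIBLE ETERNAL SOLUTIONS** (any covariant viscosity `ν̂ ≥ 0`; see the
module docstring): `W_{n+p} = W_n(· − T)` with `p ≥ 1`, `T > 0`, `‖W‖ ≤ B`, `W_{n₁}(σ₁) ≠ 0` for some shell `n₁ ≥ 0`
⟹ `Λ ≤ C_A·B·(Λ²−1)`.
[cite: Tao2016AveragedNS, §4 Lemma 4.1 (4.8)–(4.10) with (4.3), the viscous equation before Thm. 4.2, §6.4; this file + `weightedSum_le`] -/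
theorem blockSelfSimilar_amplitude_floor (hε : 0 < ε₀) (hW : IsEternalVisc ε₀ νh α W) (hc : IsCancellingCoeff α)
    {B : ℝ} (hB : ∀ k σ, ‖W k σ‖ ≤ B) {p : ℕ} (hp : 0 < p) {T : ℝ} (hT : 0 < T)
    (hD : ∀ (n : ℤ) (σ : ℝ), W (n + p) σ = W n (σ - T)) {n₁ : ℕ} {σ₁ : ℝ} (hne : W n₁ σ₁ ≠ 0) :
    bigLam ε₀ ≤ fluxConst α * B * (bigLam ε₀ ^ 2 - 1) := by
  have hΛ : 0 < bigLam ε₀ := bigLam_pos (by linarith)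
  have hΛ1 : 1 < bigLam ε₀ := by unfold bigLam; exact Real.one_lt_rpow (by linarith) (by norm_num)
  have hΛ2 : 1 < bigLam ε₀ ^ 2 := by nlinarith
  have hB0 : 0 ≤ B := (norm_nonneg _).trans (hB n₁ σ₁)
  obtain ⟨A, hA⟩ := exists_physEnergy_le hε hW ⟨B, hB⟩ (-1)
  set c : ℝ := 2 * fluxConst α * (bigLam ε₀)⁻¹ * B with hcdef
  have hc0 : 0 ≤ c := by have := fluxConst_nonneg α; positivity
  set μb : ℝ := Real.exp (2 * T) / (bigLam ε₀ ^ 2) ^ p with hμb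
  have hμbpos : 0 < μb := by rw [hμb]; positivity
  have hE₁ : 0 < physEnergy ε₀ W n₁ σ₁ := by
    unfold physEnergy
    have h1 : 0 < ‖W (n₁ : ℤ) σ₁‖ := norm_pos_iff.2 hne
    have h2 : 0 < bigLam ε₀ ^ (n₁ : ℤ) := zpow_pos hΛ _
    positivity
  -- STEP 1: for every weight `1 ≤ θ < Λ²`, `log(θᵖ μb) ≤ (θ−1)·c·T`
  have hstep : ∀ θ : ℝ, 1 ≤ θ → θ < bigLam ε₀ ^ 2 → Real.log (θ ^ p * μb) ≤ (θ - 1) * c * T := by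
    intro θ hθ1 hθ2
    have hθ0 : 0 < θ := by linarith
    by_contra hlt
    push Not at hlt
    set K : ℝ := (θ - 1) * c with hK
    set ρ' : ℝ := θ ^ p * μb * Real.exp (-(K * T)) with hρ'
    have hρ'1 : 1 < ρ' := by
      have h1 : Real.exp (K * T) < θ ^ p * μb := by
        have := Real.exp_lt_exp.2 hlt
        rwa [Real.exp_log (mul_pos (pow_pos hθ0 p) hμbpos)] at this
      rw [hρ', Real.exp_neg, lt_mul_inv_iff₀ (Real.exp_pos _), one_mul]
      exact h1
    set e₀ : ℝ := θ ^ n₁ * physEnergy ε₀ W n₁ σ₁ with he₀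
    have he₀pos : 0 < e₀ := mul_pos (pow_pos hθ0 _) hE₁
    set δ₀ : ℝ := B ^ 2 * Real.exp (2 * σ₁) / (1 - θ / bigLam ε₀ ^ 2) with hδ₀
    have hfront : ∀ j : ℕ, ρ' ^ j * e₀ ≤ δ₀ + c * A * ((j : ℝ) * T) := by
      intro j
      set k : ℕ := n₁ + j * p with hk
      have hj0 : (0 : ℝ) ≤ (j : ℝ) * T := by positivity
      have hσ : σ₁ ≤ σ₁ + (j : ℝ) * T := by linarith
      have h := weightedSum_le hε hW hc hB hθ1 hθ2 hA k hσ
      have hsingle : θ ^ k * physEnergy ε₀ W (k : ℤ) (σ₁ + (j : ℝ) * T)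
          ≤ ∑ i ∈ Finset.range (k + 1), θ ^ i * physEnergy ε₀ W i (σ₁ + (j : ℝ) * T) :=
        Finset.single_le_sum (f := fun i : ℕ => θ ^ i * physEnergy ε₀ W i (σ₁ + (j : ℝ) * T))
          (fun i _ => mul_nonneg (pow_nonneg hθ0.le i) (physEnergy_nonneg ε₀ W _ _))
          (Finset.mem_range.2 (Nat.lt_succ_self k))
      have hval : θ ^ k * physEnergy ε₀ W (k : ℤ) (σ₁ + (j : ℝ) * T) = (θ ^ p * μb) ^ j * e₀ := by
        rw [hk, hμb, he₀]; exact weightedEnergy_blockOrbit hε hD θ n₁ j σ₁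
      have htime : σ₁ + (j : ℝ) * T - σ₁ = (j : ℝ) * T := by ring
      rw [htime, ← hcdef, ← hK, ← hδ₀] at h
      have hexp : ρ' ^ j * Real.exp (K * ((j : ℝ) * T)) = (θ ^ p * μb) ^ j := by
        rw [hρ', show (θ ^ p * μb * Real.exp (-(K * T))) ^ j = (θ ^ p * μb) ^ j * Real.exp (-(K * T)) ^ j from mul_pow _ _ _,
          ← Real.exp_nat_mul, mul_assoc, ← Real.exp_add,
          show (j : ℝ) * -(K * T) + K * ((j : ℝ) * T) = 0 by ring, Real.exp_zero, mul_one]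
      have hE : 0 < Real.exp (K * ((j : ℝ) * T)) := Real.exp_pos _
      have hmain : ρ' ^ j * e₀ * Real.exp (K * ((j : ℝ) * T)) ≤ (δ₀ + c * A * ((j : ℝ) * T)) * Real.exp (K * ((j : ℝ) * T)) := by
        have h1 := (hval ▸ hsingle).trans h
        rw [← hexp] at h1
        calc ρ' ^ j * e₀ * Real.exp (K * ((j : ℝ) * T)) = ρ' ^ j * Real.exp (K * ((j : ℝ) * T)) * e₀ := by ring
          _ ≤ _ := h1
      exact le_of_mul_le_mul_right hmain hE
    have hlin : Tendsto (fun j : ℕ => (δ₀ + c * A * ((j : ℝ) * T)) / ρ' ^ j) atTop (𝓝 0) := by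
      have := ((tendsto_pow_const_div_const_pow_of_one_lt 0 hρ'1).const_mul δ₀).add
        ((tendsto_pow_const_div_const_pow_of_one_lt 1 hρ'1).const_mul (c * A * T))
      rw [mul_zero, mul_zero, add_zero] at this
      refine this.congr fun k => ?_
      simp only [pow_zero, pow_one]; ring
    have hge : ∀ j : ℕ, e₀ ≤ (δ₀ + c * A * ((j : ℝ) * T)) / ρ' ^ j := by
      intro j
      have hρk : 0 < ρ' ^ j := pow_pos (by linarith) _
      rw [le_div_iff₀ hρk, mul_comm]; exact hfront j
    have := ge_of_tendsto hlin (Eventually.of_forall hge)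
    linarith
  -- STEP 2: `θ ↑ Λ²`
  by_contra hlt
  push Not at hlt
  have hval : 0 < Real.log ((bigLam ε₀ ^ 2) ^ p * μb) - (bigLam ε₀ ^ 2 - 1) * c * T := by
    have hlog : Real.log ((bigLam ε₀ ^ 2) ^ p * μb) = 2 * T := by
      rw [hμb, mul_div_cancel₀ _ (by positivity : (bigLam ε₀ ^ 2) ^ p ≠ 0), Real.log_exp]
    rw [hlog, hcdef]
    have h1 : (bigLam ε₀ ^ 2 - 1) * (2 * fluxConst α * (bigLam ε₀)⁻¹ * B) * T
        = 2 * T * ((fluxConst α * B * (bigLam ε₀ ^ 2 - 1)) / bigLam ε₀) := by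
      field_simp
    rw [h1]
    have h2 : fluxConst α * B * (bigLam ε₀ ^ 2 - 1) / bigLam ε₀ < 1 := (div_lt_one hΛ).2 hlt
    nlinarith
  have hcont : ContinuousAt (fun θ => Real.log (θ ^ p * μb) - (θ - 1) * c * T) (bigLam ε₀ ^ 2) := by
    have : (bigLam ε₀ ^ 2) ^ p * μb ≠ 0 := (mul_pos (by positivity) hμbpos).ne'
    fun_prop (disch := exact this)
  have hev : ∀ᶠ θ in 𝓝 (bigLam ε₀ ^ 2), 0 < Real.log (θ ^ p * μb) - (θ - 1) * c * T :=
    hcont.eventually (lt_mem_nhds hval)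
  have hev3 : ∀ᶠ θ in 𝓝[<] (bigLam ε₀ ^ 2), θ ∈ Ioo 1 (bigLam ε₀ ^ 2) := Ioo_mem_nhdsLT hΛ2
  have hev2 : ∀ᶠ θ in 𝓝[<] (bigLam ε₀ ^ 2), 0 < Real.log (θ ^ p * μb) - (θ - 1) * c * T ∧ θ ∈ Ioo 1 (bigLam ε₀ ^ 2) :=
    (hev.filter_mono nhdsWithin_le_nhds).and hev3
  obtain ⟨θ, hθpos, hθ1, hθ2⟩ := hev2.exists
  have := hstep θ hθ1.le hθ2
  have _ := hp
  linarith

end Summit.NavierStokesRegularity.NavierStokesRegularity.Theorems.NoSurvivingEternalViscBddOne.WeightedGrowth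

end
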